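import Summits.QuantumFields.YangMills.Theorems.WeakCouplingRatesHarmonicInteriorDefs
import Literature.Probability.LatticeModels.LastExitDecomposition
import HarnessLib

/-!
# Interior regularity of lattice-harmonic functions, file 2/3: Poisson representation and the kernel representation

Helper file (`--supports stmt-QuantumFields-19609`); theorems only.

WHY (crux `BulkDominatesColdBoxW`, stmt-QuantumFields-19609, open stubs L1a/L1b; seat `ym-spine-20043-p1` g2 re-targeted by director-ym
LINE №76/№78 to the BACKGROUND piece of L1b `stub_goodBoundaryMeanSmooth`).  L1b compares the box-kernel means of the plaquette cost at
the centre `p` and at `p + T e₀` (depth `H = ⌈β^θ⌉`, `T = ⌈β^A⌉ ≪ H`) uniformly over crude-good boundary data; the leading (classical)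
contribution is `c_{p'}(Ū) − c_p(Ū)` for the minimal-action background `Ū` extending the datum, of size `2 sup|F̄| · T · sup|∇F̄|`, so the
estimate rests on the INTERIOR GRADIENT BOUND `|∇F̄| ≲ sup|F̄| / H`.  Each component of the linearised curvature is LATTICE-HARMONIC in
the interior (`Δ_Hodge = −Δ` componentwise on `ℤ⁴`); the scalar input is the classical interior difference estimate for harmonic
functions (Lawler 1991 Thm. 1.7.1 (a); Lawler–Limic 2010 Thm. 6.3.8), proved in this three-file series
(`…HarmonicInteriorDefs` → `…HarmonicInteriorKernel` → `…HarmonicInteriorGradient`) from the tree's Green-function bounds.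

This file (general `d ≥ 3`):
* `poisson_repr` — a finitely supported `v` is `v = gHalf ∗ (−Δ v)` (uniqueness by `IsZdHarmonicOn.eq_zero_of_tendsto_zero` and
  `tendsto_latticeGreen_cofinite`);
* `latticeLaplacianZd_mul` (product rule), `sum_sbox_shift` (Abel re-indexing on a sup-box);
* **`harmonic_eq_sum_kernel`** — for `u` with `Δu = 0` wherever all `|z_k| < 2r` and `|x_k| ≤ r`:
  `u(x) = Σ_{z ∈ sbox(2r+1)} u(z) K₁(x, z)` (discrete `∫ u (GΔχ + 2∇G·∇χ)`), and `harmonic_sub_eq_sum_kernel` for the neighbour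
  difference `u(x+eⱼ) − u(x)`.

No sorry, standard axioms.  NOT a claim about the mass gap.
-/

set_option autoImplicit false

noncomputable section

open Finset Filter Topology
open Literature.Probability.LatticeModels
open Literature.MathematicalPhysics.QuantumFieldTheory.LatticeForm (e)

namespace Summit.QuantumFields.YangMills.Theorems.WeakCouplingRates.HarmonicInterior

variable {d : ℕ}

/-! ## §1 Poisson representation of finitely supported lattice functions -/



/-- `Δ_x g(x − y) = −[x = y]`. [folklore] -/
theorem latticeLaplacianZd_gHalf_sub (hd : 3 ≤ d) (y x : Site d) :
    latticeLaplacianZd (fun z => gHalf (z - y)) x = -(if x = y then 1 else 0) := by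
  have h := latticeLaplacianZd_comp_add (fun z : Site d => latticeGreen z / 2) (-y) x
  simp only [← sub_eq_add_neg] at h
  unfold gHalf
  rw [h, latticeLaplacianZd_half_latticeGreen d hd]
  simp [sub_eq_zero]

/-- **Poisson representation.**  If `v` vanishes off the finite set `S` and `Δ v` vanishes off the finite set `T`, then
`v(x) = Σ_{y ∈ T} g(x − y) (−Δ v)(y)` for every `x` (`d ≥ 3`): both sides have the same Laplacian and tend to `0` at
infinity. [folklore] -/
theorem poisson_repr (hd : 3 ≤ d) {v : Site d → ℝ} {S T : Finset (Site d)} (hv : ∀ x ∉ S, v x = 0)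
    (hT : ∀ x ∉ T, latticeLaplacianZd v x = 0) (x : Site d) :
    v x = ∑ y ∈ T, gHalf (x - y) * (-latticeLaplacianZd v y) := by
  set w : Site d → ℝ := fun x => ∑ y ∈ T, gHalf (x - y) * (-latticeLaplacianZd v y) with hw
  have hΔw : ∀ z, latticeLaplacianZd w z = latticeLaplacianZd v z := by
    intro z
    rw [hw, latticeLaplacianZd_sum_mul T (fun x y => gHalf (x - y)) (fun y => -latticeLaplacianZd v y) z]
    have : ∀ y ∈ T, latticeLaplacianZd (fun x => gHalf (x - y)) z * -latticeLaplacianZd v y =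
        if z = y then latticeLaplacianZd v y else 0 := by
      intro y _
      rw [latticeLaplacianZd_gHalf_sub hd]
      split_ifs <;> ring
    rw [Finset.sum_congr rfl this, Finset.sum_ite_eq]
    split_ifs with hz
    · rfl
    · exact (hT z hz).symm
  have hharm : IsZdHarmonicOn (w - v) Set.univ := by
    intro z _
    rw [latticeLaplacianZd_sub, hΔw, sub_self]
  have hd0 : 0 < d := by omega
  have hv0 : Tendsto v cofinite (𝓝 0) := by
    refine tendsto_const_nhds.congr' ?_
    refine (Filter.eventually_cofinite.2 ?_).mono fun z hz => hz
    refine S.finite_toSet.subset fun z hz => ?_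
    by_contra hzS
    exact hz (hv z hzS).symm
  have hw0 : Tendsto w cofinite (𝓝 0) := by
    have hterm : ∀ y ∈ T, Tendsto (fun x => gHalf (x - y) * (-latticeLaplacianZd v y)) cofinite (𝓝 0) := by
      intro y _
      have h1 : Tendsto (fun x : Site d => x - y) cofinite cofinite := sub_left_injective.tendsto_cofinite
      have h2 : Tendsto (fun x : Site d => gHalf (x - y)) cofinite (𝓝 0) := by
        have := ((tendsto_latticeGreen_cofinite d hd).comp h1).div_const 2
        simpa [gHalf] using this
      simpa using h2.mul_const (-latticeLaplacianZd v y)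
    have := tendsto_finsetSum T hterm
    simpa [hw] using this
  have hlim : Tendsto (w - v) cofinite (𝓝 0) := by
    have h := hw0.sub hv0
    rw [sub_zero] at h
    exact h
  have h0 := hharm.eq_zero_of_tendsto_zero hd0 hlim x
  have : v x = w x := by rw [Pi.sub_apply] at h0; linarith
  rw [this]

/-- **Product rule for the lattice Laplacian.** -/
theorem latticeLaplacianZd_mul (χ u : Site d → ℝ) (y : Site d) :
    latticeLaplacianZd (fun z => χ z * u z) y = χ y * latticeLaplacianZd u y +
      ∑ i, ((χ (y + e i) - χ y) * u (y + e i) + (χ (y - e i) - χ y) * u (y - e i)) := by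
  have key : ∀ i : Fin d, χ (y + e i) * u (y + e i) + χ (y - e i) * u (y - e i) =
      χ y * (u (y + e i) + u (y - e i)) +
        ((χ (y + e i) - χ y) * u (y + e i) + (χ (y - e i) - χ y) * u (y - e i)) := fun i => by ring
  simp only [latticeLaplacianZd, ← e_def]
  rw [Finset.sum_congr rfl fun i _ => key i, Finset.sum_add_distrib, ← Finset.mul_sum]
  ring

/-- **Shifting a sum over a sup-box** by a short vector, for a summand vanishing off the smaller box. -/
theorem sum_sbox_shift {R : ℕ} (F : Site d → ℝ) (hF : ∀ z ∉ sbox R, F z = 0) (v : Site d) (hv : ∀ k, |v k| ≤ 1) :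
    ∑ y ∈ sbox (R + 1), F (y + v) = ∑ y ∈ sbox (R + 1), F y := by
  have hinj : Set.InjOn (fun y : Site d => y + v) ↑(sbox (d := d) (R + 1)) := fun a _ b _ h => add_right_cancel h
  rw [← Finset.sum_image (f := F) hinj]
  have h1 : sbox R ⊆ (sbox (R + 1)).image (fun y : Site d => y + v) := by
    intro z hz
    rw [Finset.mem_image]
    refine ⟨z - v, mem_sbox.2 fun k => ?_, sub_add_cancel z v⟩
    have h := abs_le.1 (mem_sbox.1 hz k)
    have hvk := abs_le.1 (hv k)
    rw [Pi.sub_apply]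
    push_cast
    exact abs_le.2 ⟨by omega, by omega⟩
  have h2 : sbox R ⊆ sbox (d := d) (R + 1) := by
    intro z hz
    rw [mem_sbox] at *
    intro k; have := hz k; push_cast; omega
  rw [← Finset.sum_subset h1 fun z _ hz => hF z hz, ← Finset.sum_subset h2 fun z _ hz => hF z hz]


/-- **The kernel representation of a harmonic function near the centre of the cut-off.**  If `Δ u = 0` at every site with
all `|z_k| < 2r` and `|x_k| ≤ r` for all `k`, then `u(x) = Σ_{z ∈ sbox(2r+1)} u(z) K₁(x, z)` (`d ≥ 3`, `r ≥ 1`). [folklore] -/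
theorem harmonic_eq_sum_kernel (hd : 3 ≤ d) {r : ℕ} (hr : 0 < r) (u : Site d → ℝ)
    (hharm : ∀ z : Site d, (∀ k, |z k| < 2 * (r : ℤ)) → latticeLaplacianZd u z = 0)
    (x : Site d) (hx : ∀ k, |x k| ≤ r) :
    u x = ∑ z ∈ sbox (2 * r + 1), u z * kernel₁ r x z := by
  set v : Site d → ℝ := fun z => cutoff r z * u z with hv
  have hzero : ∀ (w : Site d) (k : Fin d), 2 * (r : ℤ) ≤ |w k| → v w = 0 := fun w k hw => by
    simp only [hv]; rw [cutoff_eq_zero (k := k) hw, zero_mul]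
  -- support of `v` and of `Δ v`
  have hv0 : ∀ z ∉ sbox (d := d) (2 * r + 1), v z = 0 := by
    intro z hz
    obtain ⟨k, hk⟩ := not_mem_sbox.1 hz
    push_cast at hk
    exact hzero z k (by omega)
  have hΔv0 : ∀ z ∉ sbox (d := d) (2 * r + 1), latticeLaplacianZd v z = 0 := by
    intro z hz
    obtain ⟨k, hk⟩ := not_mem_sbox.1 hz
    push_cast at hk
    have hk' := lt_abs.1 hk
    have hk1 : ∀ i : Fin d, v (z + e i) = 0 ∧ v (z - e i) = 0 := by
      intro i
      by_cases hki : k = i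
      · subst hki
        exact ⟨hzero _ k (by rw [add_e_apply_same]; exact le_abs.2 (by omega)),
          hzero _ k (by rw [sub_e_apply_same]; exact le_abs.2 (by omega))⟩
      · exact ⟨hzero _ k (by rw [add_e_apply_ne z hki]; omega), hzero _ k (by rw [sub_e_apply_ne z hki]; omega)⟩
    simp only [latticeLaplacianZd, ← e_def]
    rw [Finset.sum_eq_zero fun i _ => by rw [(hk1 i).1, (hk1 i).2, add_zero], hzero z k (by omega)]
    ring
  -- Poisson representation of `v`, and `χ(x) = 1`
  have hP := poisson_repr hd hv0 hΔv0 x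
  have hvx : v x = u x := by simp only [hv]; rw [cutoff_eq_one hr hx, one_mul]
  rw [← hvx, hP]
  -- the Laplacian of `v`: product rule and `χ Δu = 0`
  have hΔv : ∀ y, -latticeLaplacianZd v y = ∑ i, (dminus r i y * u (y - e i) - dplus r i y * u (y + e i)) := by
    intro y
    simp only [hv]
    rw [latticeLaplacianZd_mul]
    have h0 : cutoff r y * latticeLaplacianZd u y = 0 := by
      by_cases hc : cutoff r y = 0
      · rw [hc, zero_mul]
      · rw [hharm y (forall_abs_lt_of_cutoff_ne_zero hc), mul_zero]
    rw [h0, zero_add, ← Finset.sum_neg_distrib]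
    refine Finset.sum_congr rfl fun i _ => ?_
    simp only [dminus, dplus]; ring
  simp_rw [hΔv]
  have hL : ∑ y ∈ sbox (2 * r + 1), gHalf (x - y) * ∑ i, (dminus r i y * u (y - e i) - dplus r i y * u (y + e i)) =
      ∑ i : Fin d, ∑ y ∈ sbox (2 * r + 1), gHalf (x - y) * (dminus r i y * u (y - e i) - dplus r i y * u (y + e i)) := by
    simp_rw [Finset.mul_sum]; rw [Finset.sum_comm]
  have hR : ∑ z ∈ sbox (2 * r + 1), u z * kernel₁ r x z =
      ∑ i : Fin d, ∑ z ∈ sbox (2 * r + 1), u z * (gHalf (x - z - e i) * dplus r i z - gHalf (x - z + e i) * dminus r i z) := by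
    simp_rw [kernel₁, Finset.mul_sum]; rw [Finset.sum_comm]
  rw [hL, hR]
  refine Finset.sum_congr rfl fun i _ => ?_
  -- re-index the two pieces
  have hA : ∑ y ∈ sbox (2 * r + 1), gHalf (x - y) * (dminus r i y * u (y - e i)) =
      ∑ z ∈ sbox (2 * r + 1), gHalf (x - z - e i) * dplus r i z * u z := by
    have hF : ∀ z ∉ sbox (d := d) (2 * r), gHalf (x - z - e i) * dplus r i z * u z = 0 := fun z hz => by
      rw [dplus_eq_zero_of_not_mem hz, mul_zero, zero_mul]
    rw [← sum_sbox_shift (R := 2 * r) _ hF (-e i) (fun k => by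
      rw [Pi.neg_apply, abs_neg]
      by_cases h : k = i
      · subst h; simp
      · simp [h])]
    refine Finset.sum_congr rfl fun y _ => ?_
    rw [← sub_eq_add_neg, dplus_sub_e, show x - (y - e i) - e i = x - y by abel]
    ring
  have hB : ∑ y ∈ sbox (2 * r + 1), gHalf (x - y) * (dplus r i y * u (y + e i)) =
      ∑ z ∈ sbox (2 * r + 1), gHalf (x - z + e i) * dminus r i z * u z := by
    have hF : ∀ z ∉ sbox (d := d) (2 * r), gHalf (x - z + e i) * dminus r i z * u z = 0 := fun z hz => by
      rw [dminus_eq_zero_of_not_mem hz, mul_zero, zero_mul]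
    rw [← sum_sbox_shift (R := 2 * r) _ hF (e i) (fun k => by
      by_cases h : k = i
      · subst h; simp
      · simp [h])]
    refine Finset.sum_congr rfl fun y _ => ?_
    rw [dminus_add_e, show x - (y + e i) + e i = x - y by abel]
    ring
  have hsplit : ∀ y ∈ sbox (d := d) (2 * r + 1),
      gHalf (x - y) * (dminus r i y * u (y - e i) - dplus r i y * u (y + e i)) =
      gHalf (x - y) * (dminus r i y * u (y - e i)) - gHalf (x - y) * (dplus r i y * u (y + e i)) := fun y _ => by ring
  rw [Finset.sum_congr rfl hsplit, Finset.sum_sub_distrib, hA, hB, ← Finset.sum_sub_distrib]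
  refine Finset.sum_congr rfl fun z _ => ?_
  ring

/-- **The difference of `u` at neighbouring deep sites** as a sum against the `x`-difference of the kernel. [folklore] -/
theorem harmonic_sub_eq_sum_kernel (hd : 3 ≤ d) {r : ℕ} (hr : 0 < r) (u : Site d → ℝ)
    (hharm : ∀ z : Site d, (∀ k, |z k| < 2 * (r : ℤ)) → latticeLaplacianZd u z = 0)
    (x : Site d) (hx : ∀ k, |x k| + 1 ≤ r) (j : Fin d) :
    u (x + e j) - u x = ∑ z ∈ sbox (2 * r + 1), u z * (kernel₁ r (x + e j) z - kernel₁ r x z) := by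
  have h1 := harmonic_eq_sum_kernel hd hr u hharm x fun k => by have := hx k; omega
  have h2 := harmonic_eq_sum_kernel hd hr u hharm (x + e j) fun k => by
    have h := abs_le.1 (show |x k| ≤ (r : ℤ) - 1 by have := hx k; omega)
    by_cases hkj : k = j
    · subst hkj; rw [add_e_apply_same]; exact abs_le.2 ⟨by omega, by omega⟩
    · rw [add_e_apply_ne x hkj]; exact abs_le.2 ⟨by omega, by omega⟩
  rw [h1, h2, ← Finset.sum_sub_distrib]
  exact Finset.sum_congr rfl fun z _ => by ring

end Summit.QuantumFields.YangMills.Theorems.WeakCouplingRates.HarmonicInterior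

end
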